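import Summits.NavierStokesRegularity.NavierStokesRegularity.Theses.FlatSwirlGauge
import HarnessLib.Audit

/-!
# Birth skeleton (BC3) of the crux `FlatSwirlGauge.CriticalSwirlRegularity`

(crux item `stmt-NavierStokesRegularity-1253`, rank 3, route `route-NavierStokesRegularity-FlatSwirlGauge`;
tree path `Cruxes/CriticalSwirlRegularity/Lines/birth.lean`; registrar
`planner-skel-stmt-NavierStokesRegularity-1253-0`, 2026-08-17. The route predates the Lean birth certificate;
this file supplies BC3 retroactively. No `Disproof.lean`, no dead lines and no earlier `Lines/*` exist for this
crux (`ledger crux ls`, 2026-08-17); negatives index of the summit read.)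

THE CRUX (fixed, as typed). `CriticalSwirlRegularity` (CSR): `ν > 0`, `(u,p)` classical on `ℝ³ × [0,T)`,
Leray–Hopf from a rapidly decaying datum; if `(u,p)` carries a FLAT SWIRL GAUGE `(ρ, C₀, M, α, b, d)` on the
backward cylinder `Q_ρ(T,x₀) = (T−ρ²,T) × B_ρ(x₀)` (bounded `C²` momentum `α`, first integral of the vorticity
`ω·∇α = 0`, chart nondegeneracy `|ω| d ≤ C₀|∇α|`, flat transport `(∂ₜ+u·∇)α = ν(Δα + b·∇α)` with axis-type drift
`|b| d ≤ C₀`, and the TYPED thinness clause `vol({d<δ} ∩ B_ρ(x₀)) ≤ C₀δ²ρ`), then `u` is bounded on some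
`(T−r²,T) × B_r(x₀)`.

THE CUT — "a-priori modulus + criterion", the architecture of every printed partial result on the exactly-flat
model `α = Γ = r u_θ` (LeiZhang2017 Cor. 1.3 / Wei2016 Cor. 1.1: an axis modulus of `Γ` ⇒ regular; Pan2016,
Seregin2021, ChenTsaiZhang2022 Prop. 1.2: slightly supercritical control ⇒ oscillation decay of `Γ` at axis
points ⇒ that modulus), de-symmetrised, plus ONE structural stub that isolates the typing debt recorded on this
item by the route reviews (passes 3–7, 2026-08-15: the typed thinness clause is global on `B_ρ(x₀)` and admits
point-degenerate `d = ‖x−x₀‖^{3/2}`, so the `|ω|`, `|b|` envelopes are supercritical at `x₀`; the intended clause is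
the LOCAL Ahlfors-type upper 1-density over sub-balls, typed there and copied verbatim below as `THIN_loc`).
Write `G_typed` for the crux's inline gauge block and `G_loc` for the same block with `THIN_loc` in place of the
global clause.

* `stub_axislikeGaugeAtSingularity` [structural, FG-flavoured; L]: `G_typed(α,b,d)` on `Q_ρ(T,x₀)` AND `u`
  unbounded on every backward cylinder at `(T,x₀)` ⇒ the SAME momentum `α` is the momentum of an axis-like flat
  gauge: `∃ ρ₁ C₁ M₁ b₁ d₁` with `G_loc(α,b₁,d₁)` on `Q_{ρ₁}(T,x₀)`. Informally: at a genuine singularity the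
  sublevel sets of `q_α = |∇α|/|ω|` and of `1/|b_min(α)|` are filamentary (locally 1-Ahlfors-thin), not merely of
  small global measure. This is exactly the gap between the typed and the intended crux; when the planner
  restates 1252/1253/1254 over `THIN_loc` it becomes the identity and drops out. Irrefutable without a blow-up
  (its hypothesis is FG's hypothesis); NOT provable cheaply: the unconditional version is false (smooth no-swirl
  axisymmetric flows admit bounded `C²` axisymmetric first integrals with a degenerate critical point whose
  `q`-sublevel sets are globally `δ²`-thin but contain balls of radius `δ^{2/3}`).
* `stub_momentumUniformContinuity` [the analytic heart; XL]: `G_loc` on `Q_ρ(T,x₀)` ⇒ the momentum `α` is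
  UNIFORMLY CONTINUOUS on some smaller cylinder `Q_{ρ₂}(T,x₀)` up to the blow-up time (any modulus; typed
  `∀ ε ∃ η`). De Giorgi–Nash–Moser / oscillation decay for the flat transport law
  `(∂ₜ + u·∇ − νΔ − ν b·∇)α = 0` with divergence-free drift `u` (energy class only — supercritical) and
  axis-type drift `|b| ≤ C₀/d` at a locally thin set. Exactly-flat shadow: uniform continuity of `Γ` at the
  axis up to `T` — equivalent there to the open axisymmetric-with-swirl problem (conjecture
  `AxisymmetricSwirlRegularity`); printed technology reaches it only under slightly supercritical hypotheses on
  `u` (ChenTsaiZhang2022 Prop. 1.2 / Thm. 1.3, Seregin2021, Pan2016) or for drifts in `L∞(BMO⁻¹)`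
  (SereginEtAl2012 Thms 1.1–1.2, with counterexamples past that class, Thms 1.3, 1.5). Deliberately the WEAKEST
  natural a-priori statement (continuity, not Hölder, not Lipschitz): with `u ≡ 0` the local clause still admits
  parabolically shrinking bumps `(T−t)^a H((x−x₀)/√(κν(T−t)))`, `a = |ΔH(0)|/(H(0)κ)`, `κ ≲ C₀^{3/2}`, whose
  gradients blow up at the vertex while the momentum stays (Hölder-)continuous — so a Lipschitz cut would be a
  mis-cut, and no Hölder exponent can be universal.
* `stub_continuousMomentumRegularity` [flat-class regularity criterion; L]: `G_loc` on `Q_ρ(T,x₀)` AND `α`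
  uniformly continuous on some `Q_{ρ₂}(T,x₀)` ⇒ `u` bounded near `(T,x₀)` (the crux's conclusion verbatim).
  Exactly-flat shadow: `Γ` uniformly continuous near an axis vertex (`Γ = 0` on the axis, so `|Γ| ≤ m(r)` with
  `m → 0`) ⇒ regular point — in print for the moduli `m = C|ln r|⁻²` (LeiZhang2017 Cor. 1.3, in-tree fact
  `LeiZhang2017_logModulus_regularity`) and `|ln r|^{-3/2}` (Wei2016 Cor. 1.1), and for relative smallness
  `‖Γ‖∞ ≤ δ M₀⁻¹` (LeiZhang2017 Thm. 1.4, in-tree `LeiZhang2017_smallSwirl_regularity`); for a bare modulus it is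
  open even there, but the stub is a WEAKENING of the (intended) crux, hence true if the route is.

COMPOSITION. `CriticalSwirlRegularity_of : Theses.FlatSwirlGauge.CriticalSwirlRegularity` (the ONLY theorem of
this file concluding the crux; A12 layer invariant: conclusion = the crux BY NAME, no `Prop` hypotheses,
placeholders only inside the three declared stubs, which it uses by name): given the typed gauge, case on
boundedness of `u` near `(T,x₀)`; in the unbounded case `stub_axislikeGaugeAtSingularity` upgrades the gauge to
an axis-like one with the same momentum, `stub_momentumUniformContinuity` gives the modulus,
`stub_continuousMomentumRegularity` the bound. Its CLOSED twin with the three stub STATEMENTS as hypotheses,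
`CriticalSwirlRegularity_of_hyps : <sig₁> → <sig₂> → <sig₃> → CriticalSwirlRegularity` (same proof; axioms
`propext / Classical.choice / Quot.sound`, no placeholder anywhere), is the registrar's evidence file
`bc/CriticalSwirlRegularity_birth_closed.lean` (attached to the crux item).

BC3 PROBES (folder `bc/probe_stub*.lean`, `lean check`; results quoted in `Lines/birth.md` and NOTES.md): for each
stub `S`, `S → CriticalSwirlRegularity` and `S → NavierStokesRegularity` by `first | exact? | simpa | aesop` FAIL —
no stub is cheaply the crux or the summit (S1 and S2 conclude gauge data / a modulus, not boundedness; S3 needs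
the modulus and the local clause, neither derivable from the typed gauge).

Disproof used: none exists for this crux (no `Cruxes/CriticalSwirlRegularity/Disproof.lean`, no `Negative/`
lemmas; `ledger negatives --problem NavierStokesRegularity` has no statement about flat gauges). Dead lines: none.
-/

noncomputable section

open Set MeasureTheory Filter Topology
open Literature.Analysis.FluidPDE

namespace Summit.NavierStokesRegularity.NavierStokesRegularity.Cruxes.CriticalSwirlRegularity.Birth

set_option linter.unusedVariables false
set_option linter.dupNamespace false

/-- **stub 1 — `stub_axislikeGaugeAtSingularity` (structural; L; OPEN, irrefutable without a blow-up).**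
At a genuine singularity `(T,x₀)` (`u` unbounded on every backward cylinder there — FG's hypothesis, crux 1252),
the momentum `α` of ANY typed flat swirl gauge on `Q_ρ(T,x₀)` is the momentum of an AXIS-LIKE flat swirl gauge on
some `Q_{ρ₁}(T,x₀)`: new drift `b₁`, degeneracy function `d₁` and constants, the same `α`, and the LOCAL
Ahlfors-type thinness `vol({d₁<δ} ∩ B(y,s)) ≤ C₁δ²s` for every sub-ball `B(y,s) ⊆ B(x₀,ρ₁)` and `0<δ<s` (the
clause typed by the route reviews on this item, 2026-08-15). Why plausible: near a singularity the vorticity is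
large exactly where the chart degenerates, and the route's bet (FG) is that this set is vortex-filament-like;
the typed clause already forces upper Minkowski dimension ≤ 1 of `{d = 0}` globally, the stub asks for it ball by
ball. Why it might fail: a singular flow could carry a first integral flat only in the weak (globally thin)
sense, with `q_α = |∇α|/|ω|` vanishing to order `3/2` at `x₀`. Leans on: nothing in tree (new). Sources: route
reviews of stmt-NavierStokesRegularity-1253 (passes 3–7), KNSS2009 §5 (axis geometry of the exactly-flat case),
CKN1982 (P¹-null singular set). -/
theorem stub_axislikeGaugeAtSingularity :
    ∀ (ν T : ℝ), 0 < ν → 0 < T →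
      ∀ (u : ℝ → EuclideanSpace ℝ (Fin 3) → EuclideanSpace ℝ (Fin 3)) (p : ℝ → EuclideanSpace ℝ (Fin 3) → ℝ),
        Literature.Analysis.FluidPDE.IsClassicalNSSolutionOn (Set.Ico 0 T) ν 0 u p →
        Literature.Analysis.FluidPDE.IsLerayHopfOn T ν 0 (u 0) u →
        Literature.Analysis.FluidPDE.HasRapidSpatialDecay (u 0) →
      ∀ (x₀ : EuclideanSpace ℝ (Fin 3)) (ρ C₀ M : ℝ) (α : ℝ → EuclideanSpace ℝ (Fin 3) → ℝ) (b : ℝ → EuclideanSpace ℝ (Fin 3) → EuclideanSpace ℝ (Fin 3)) (d : ℝ → EuclideanSpace ℝ (Fin 3) → ℝ),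
        (0 < ρ ∧ ρ ^ 2 < T ∧ ContDiffOn ℝ 2 (Function.uncurry α) (Set.Ioo (T - ρ ^ 2) T ×ˢ Metric.ball x₀ ρ) ∧
          (∀ t ∈ Set.Ioo (T - ρ ^ 2) T, ∀ δ ∈ Set.Ioo 0 ρ,
            MeasureTheory.volume ({x | d t x < δ} ∩ Metric.ball x₀ ρ) ≤ ENNReal.ofReal (C₀ * δ ^ 2 * ρ)) ∧
          (∀ t ∈ Set.Ioo (T - ρ ^ 2) T, ∀ x ∈ Metric.ball x₀ ρ, |α t x| ≤ M ∧
            inner ℝ (Literature.Analysis.FluidPDE.curl (u t) x) (gradient (α t) x) = 0 ∧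
            (0 < d t x → ‖Literature.Analysis.FluidPDE.curl (u t) x‖ * d t x ≤ C₀ * ‖gradient (α t) x‖ ∧ ‖b t x‖ * d t x ≤ C₀ ∧
              deriv (fun s => α s x) t + Literature.Analysis.FluidPDE.convect (u t) (α t) x =
                ν * (Laplacian.laplacian (α t) x + inner ℝ (b t x) (gradient (α t) x))))) →
        ¬ (∃ r : ℝ, 0 < r ∧ ∃ K : ℝ, ∀ t ∈ Set.Ioo (T - r ^ 2) T, 0 ≤ t → ∀ x ∈ Metric.ball x₀ r, ‖u t x‖ ≤ K) →
        ∃ (ρ₁ C₁ M₁ : ℝ) (b₁ : ℝ → EuclideanSpace ℝ (Fin 3) → EuclideanSpace ℝ (Fin 3)) (d₁ : ℝ → EuclideanSpace ℝ (Fin 3) → ℝ),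
          0 < ρ₁ ∧ ρ₁ ^ 2 < T ∧ ContDiffOn ℝ 2 (Function.uncurry α) (Set.Ioo (T - ρ₁ ^ 2) T ×ˢ Metric.ball x₀ ρ₁) ∧
          (∀ t ∈ Set.Ioo (T - ρ₁ ^ 2) T, ∀ (y : EuclideanSpace ℝ (Fin 3)) (s : ℝ), 0 < s → Metric.ball y s ⊆ Metric.ball x₀ ρ₁ →
            ∀ δ ∈ Set.Ioo 0 s, MeasureTheory.volume ({x | d₁ t x < δ} ∩ Metric.ball y s) ≤ ENNReal.ofReal (C₁ * δ ^ 2 * s)) ∧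
          (∀ t ∈ Set.Ioo (T - ρ₁ ^ 2) T, ∀ x ∈ Metric.ball x₀ ρ₁, |α t x| ≤ M₁ ∧
            inner ℝ (Literature.Analysis.FluidPDE.curl (u t) x) (gradient (α t) x) = 0 ∧
            (0 < d₁ t x → ‖Literature.Analysis.FluidPDE.curl (u t) x‖ * d₁ t x ≤ C₁ * ‖gradient (α t) x‖ ∧ ‖b₁ t x‖ * d₁ t x ≤ C₁ ∧
              deriv (fun s => α s x) t + Literature.Analysis.FluidPDE.convect (u t) (α t) x =
                ν * (Laplacian.laplacian (α t) x + inner ℝ (b₁ t x) (gradient (α t) x)))) := by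
  sorry

/-- **stub 2 — `stub_momentumUniformContinuity` (the analytic heart; XL; OPEN).** For a classical Leray–Hopf
solution with an axis-like (locally thin) flat swirl gauge on `Q_ρ(T,x₀)`, the momentum `α` is uniformly
continuous on some `Q_{ρ₂}(T,x₀)`, `0 < ρ₂ ≤ ρ`, up to the blow-up time: `∀ ε>0 ∃ η>0`, `|α(t,x) − α(s,y)| ≤ ε`
whenever `|t−s| ≤ η`, `dist x y ≤ η`. Oscillation decay (De Giorgi–Nash–Moser) for the flat transport law
`(∂ₜ + u·∇)α = ν(Δα + b·∇α)` — divergence-free drift `u` in the energy class, axis-type drift `|b| ≤ C₀/d` at a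
locally 1-thin set, bounded `α` (maximum-principle currency). Why plausible: the exactly-flat shadow is the
oscillation decay of `Γ = r u_θ` at axis points, proved under slightly supercritical control of `u`
(ChenTsaiZhang2022 Prop. 1.2, modulus `exp(−c|ln ρ|^τ)`, `τ<1`; Seregin2021; Pan2016) and for `L∞(BMO⁻¹)` drifts
(SereginEtAl2012 Thms 1.1–1.2); the gauge constants `C₀`, `M/ν` are scale-invariant, which is what a De Giorgi
iteration consumes. Why it might fail: `u` is only energy-class (supercritical) and Harnack fails past `BMO⁻¹`
drift (SereginEtAl2012 Thms 1.3, 1.5); in the exactly-flat class the statement is equivalent to the open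
conjecture `AxisymmetricSwirlRegularity`. Continuity, not Hölder/Lipschitz, on purpose (see the module
docstring: Lipschitz fails already for `u ≡ 0`, and no Hölder exponent can be universal). Sources:
ChenTsaiZhang2022, SereginEtAl2012, LeiZhang2017, KNSS2009. -/
theorem stub_momentumUniformContinuity :
    ∀ (ν T : ℝ), 0 < ν → 0 < T →
      ∀ (u : ℝ → EuclideanSpace ℝ (Fin 3) → EuclideanSpace ℝ (Fin 3)) (p : ℝ → EuclideanSpace ℝ (Fin 3) → ℝ),
        Literature.Analysis.FluidPDE.IsClassicalNSSolutionOn (Set.Ico 0 T) ν 0 u p →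
        Literature.Analysis.FluidPDE.IsLerayHopfOn T ν 0 (u 0) u →
        Literature.Analysis.FluidPDE.HasRapidSpatialDecay (u 0) →
      ∀ (x₀ : EuclideanSpace ℝ (Fin 3)) (ρ C₀ M : ℝ) (α : ℝ → EuclideanSpace ℝ (Fin 3) → ℝ) (b : ℝ → EuclideanSpace ℝ (Fin 3) → EuclideanSpace ℝ (Fin 3)) (d : ℝ → EuclideanSpace ℝ (Fin 3) → ℝ),
        (0 < ρ ∧ ρ ^ 2 < T ∧ ContDiffOn ℝ 2 (Function.uncurry α) (Set.Ioo (T - ρ ^ 2) T ×ˢ Metric.ball x₀ ρ) ∧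
          (∀ t ∈ Set.Ioo (T - ρ ^ 2) T, ∀ (y : EuclideanSpace ℝ (Fin 3)) (s : ℝ), 0 < s → Metric.ball y s ⊆ Metric.ball x₀ ρ →
            ∀ δ ∈ Set.Ioo 0 s, MeasureTheory.volume ({x | d t x < δ} ∩ Metric.ball y s) ≤ ENNReal.ofReal (C₀ * δ ^ 2 * s)) ∧
          (∀ t ∈ Set.Ioo (T - ρ ^ 2) T, ∀ x ∈ Metric.ball x₀ ρ, |α t x| ≤ M ∧
            inner ℝ (Literature.Analysis.FluidPDE.curl (u t) x) (gradient (α t) x) = 0 ∧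
            (0 < d t x → ‖Literature.Analysis.FluidPDE.curl (u t) x‖ * d t x ≤ C₀ * ‖gradient (α t) x‖ ∧ ‖b t x‖ * d t x ≤ C₀ ∧
              deriv (fun s => α s x) t + Literature.Analysis.FluidPDE.convect (u t) (α t) x =
                ν * (Laplacian.laplacian (α t) x + inner ℝ (b t x) (gradient (α t) x))))) →
        ∃ ρ₂ : ℝ, 0 < ρ₂ ∧ ρ₂ ≤ ρ ∧
          (∀ ε : ℝ, 0 < ε → ∃ η : ℝ, 0 < η ∧
            ∀ t ∈ Set.Ioo (T - ρ₂ ^ 2) T, ∀ s ∈ Set.Ioo (T - ρ₂ ^ 2) T, ∀ x ∈ Metric.ball x₀ ρ₂, ∀ y ∈ Metric.ball x₀ ρ₂,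
              |t - s| ≤ η → dist x y ≤ η → |α t x - α s y| ≤ ε) := by
  sorry

/-- **stub 3 — `stub_continuousMomentumRegularity` (flat-class regularity criterion; L; OPEN in general, a
WEAKENING of the intended crux).** Same class; an axis-like flat swirl gauge on `Q_ρ(T,x₀)` whose momentum `α` is
uniformly continuous on some `Q_{ρ₂}(T,x₀)` up to `T` forces `u` bounded on some `(T−r²,T) × B_r(x₀)` (the crux's
conclusion verbatim). Why plausible: exactly-flat shadow = "an axis modulus of `Γ` at the vertex ⇒ regular
point", in print for `|Γ| ≤ C|ln r|⁻²` (LeiZhang2017 Cor. 1.3; in-tree fact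
`Literature.Analysis.FluidPDE.LeiZhang2017_logModulus_regularity`), `|ln r|^{-3/2}` (Wei2016 Cor. 1.1) and for
relative smallness (LeiZhang2017 Thm. 1.4, `LeiZhang2017_smallSwirl_regularity`); small oscillation of the
critical quantity `α` is the ε-regularity currency (GustafsonKangTsai2007 Thm. 1.1 for the velocity analogue).
Why it might fail: for a bare modulus (no rate) the shadow is itself open, and in the general flat class the
chart clause `|ω| d ≤ C₀|∇α|` converts a modulus of `α` into vorticity control only through a gradient bound that
continuity does not give. Sources: LeiZhang2017, Wei2016, ChenFangZhang2017, GustafsonKangTsai2007, KNSS2009. -/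
theorem stub_continuousMomentumRegularity :
    ∀ (ν T : ℝ), 0 < ν → 0 < T →
      ∀ (u : ℝ → EuclideanSpace ℝ (Fin 3) → EuclideanSpace ℝ (Fin 3)) (p : ℝ → EuclideanSpace ℝ (Fin 3) → ℝ),
        Literature.Analysis.FluidPDE.IsClassicalNSSolutionOn (Set.Ico 0 T) ν 0 u p →
        Literature.Analysis.FluidPDE.IsLerayHopfOn T ν 0 (u 0) u →
        Literature.Analysis.FluidPDE.HasRapidSpatialDecay (u 0) →
      ∀ (x₀ : EuclideanSpace ℝ (Fin 3)) (ρ C₀ M : ℝ) (α : ℝ → EuclideanSpace ℝ (Fin 3) → ℝ) (b : ℝ → EuclideanSpace ℝ (Fin 3) → EuclideanSpace ℝ (Fin 3)) (d : ℝ → EuclideanSpace ℝ (Fin 3) → ℝ),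
        (0 < ρ ∧ ρ ^ 2 < T ∧ ContDiffOn ℝ 2 (Function.uncurry α) (Set.Ioo (T - ρ ^ 2) T ×ˢ Metric.ball x₀ ρ) ∧
          (∀ t ∈ Set.Ioo (T - ρ ^ 2) T, ∀ (y : EuclideanSpace ℝ (Fin 3)) (s : ℝ), 0 < s → Metric.ball y s ⊆ Metric.ball x₀ ρ →
            ∀ δ ∈ Set.Ioo 0 s, MeasureTheory.volume ({x | d t x < δ} ∩ Metric.ball y s) ≤ ENNReal.ofReal (C₀ * δ ^ 2 * s)) ∧
          (∀ t ∈ Set.Ioo (T - ρ ^ 2) T, ∀ x ∈ Metric.ball x₀ ρ, |α t x| ≤ M ∧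
            inner ℝ (Literature.Analysis.FluidPDE.curl (u t) x) (gradient (α t) x) = 0 ∧
            (0 < d t x → ‖Literature.Analysis.FluidPDE.curl (u t) x‖ * d t x ≤ C₀ * ‖gradient (α t) x‖ ∧ ‖b t x‖ * d t x ≤ C₀ ∧
              deriv (fun s => α s x) t + Literature.Analysis.FluidPDE.convect (u t) (α t) x =
                ν * (Laplacian.laplacian (α t) x + inner ℝ (b t x) (gradient (α t) x))))) →
        (∃ ρ₂ : ℝ, 0 < ρ₂ ∧ ρ₂ ≤ ρ ∧
          (∀ ε : ℝ, 0 < ε → ∃ η : ℝ, 0 < η ∧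
            ∀ t ∈ Set.Ioo (T - ρ₂ ^ 2) T, ∀ s ∈ Set.Ioo (T - ρ₂ ^ 2) T, ∀ x ∈ Metric.ball x₀ ρ₂, ∀ y ∈ Metric.ball x₀ ρ₂,
              |t - s| ≤ η → dist x y ≤ η → |α t x - α s y| ≤ ε)) →
        ∃ r : ℝ, 0 < r ∧ ∃ K : ℝ, ∀ t ∈ Set.Ioo (T - r ^ 2) T, 0 ≤ t → ∀ x ∈ Metric.ball x₀ r, ‖u t x‖ ≤ K := by
  sorry

/-- **Birth composition (the skeleton theorem).** The crux BY NAME from the three registered stubs, used by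
name: unpack the typed gauge; if `u` is already bounded near `(T,x₀)` there is nothing to do; otherwise stub 1
upgrades the gauge to an axis-like one with the same momentum, stub 2 gives the uniform modulus of the momentum
up to the blow-up time, stub 3 turns it into the bound. The same proof with the stub STATEMENTS as hypotheses
(closed; axioms `propext / Classical.choice / Quot.sound`) is `bc/CriticalSwirlRegularity_birth_closed.lean`. -/
theorem CriticalSwirlRegularity_of : Theses.FlatSwirlGauge.CriticalSwirlRegularity := by
  intro ν T hν hT u p hcl hLH hdec x₀ hgauge
  -- the crux's conclusion at (T, x₀): boundedness of u on some backward cylinder (times t ≥ 0)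
  by_cases hb : ∃ r : ℝ, 0 < r ∧ ∃ K : ℝ, ∀ t ∈ Set.Ioo (T - r ^ 2) T, 0 ≤ t → ∀ x ∈ Metric.ball x₀ r, ‖u t x‖ ≤ K
  · exact hb
  · -- a genuine singularity at (T, x₀): unpack the TYPED flat swirl gauge
    obtain ⟨ρ, C₀, M, α, b, d, hG⟩ := hgauge
    -- stub 1: the same momentum α carries an AXIS-LIKE (locally thin) flat gauge on a smaller cylinder
    obtain ⟨ρ₁, C₁, M₁, b₁, d₁, hGloc⟩ :=
      stub_axislikeGaugeAtSingularity ν T hν hT u p hcl hLH hdec x₀ ρ C₀ M α b d hG hb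
    -- stub 2: uniform continuity of the momentum up to the blow-up time
    have hUC := stub_momentumUniformContinuity ν T hν hT u p hcl hLH hdec x₀ ρ₁ C₁ M₁ α b₁ d₁ hGloc
    -- stub 3: the flat-class regularity criterion
    exact stub_continuousMomentumRegularity ν T hν hT u p hcl hLH hdec x₀ ρ₁ C₁ M₁ α b₁ d₁ hGloc hUC

end Summit.NavierStokesRegularity.NavierStokesRegularity.Cruxes.CriticalSwirlRegularity.Birth
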